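import Literature.NumberTheory.EllipticCurves.HeightCovolumeBounds
import Literature.NumberTheory.EllipticCurves.HeightCovolumeBoundsWatkinsLemmaProofs
import Literature.NumberTheory.EllipticCurves.ModularDegreeFormulaProofs
import Literature.NumberTheory.DiophantineGeometry.EllArithGlueProofs
import Literature.NumberTheory.DiophantineGeometry.MinimalDiscriminantFiniteProofs
import Literature.NumberTheory.DiophantineGeometry.MinimalDiscriminantProofs
import Mathlib.Analysis.Real.Pi.Bounds
import HarnessLib

/-!
# Watkins (2004), Theorem 5.1: the printed statement versus the printed proof, and the proved
# arithmetic step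

Companion to `Literature/NumberTheory/EllipticCurves/HeightCovolumeBounds.lean`, which vendors
M. Watkins, *Explicit lower bounds on the modular degree of an elliptic curve*, arXiv:math/0408126
(2004), Theorem 5.1, verbatim as the named fact
`Literature.NumberTheory.EllipticCurves.watkins2004_thm_5_1`:
for a semistable `E/ℚ` of conductor `N ≥ 20000`,
`deg φ_E ≥ (N/Ω) · 0.033/(2 log N)` (first conjunct) and `deg φ_E ≥ N^{7/6}/(5350 log N)` (second
conjunct), `Ω = covol(Λ_E)`.

## The first printed inequality exceeds what the paper proves by the factor `2π`

Reading the source in full (arXiv:math/0408126v2, §§1–5):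

* §1 (Shimura's identity, the starting point): `L(Sym² E, 1)/(2πΩ) = (deg φ/(N c²)) ∏_{p²∣N} U_p(1)`,
  i.e. `deg φ = (N c²/(2πΩ)) · L(Sym² E, 1) · ∏_{p²∣N} U_p(1)⁻¹`; for semistable `E` (squarefree
  `N`) the product is empty.
* Lemma 3.4: `L(Sym² f_E, 1) ≥ 0.033/log N^{(2)}` for symmetric-square conductor `N^{(2)} ≥ 142`
  (`N^{(2)} = N²` for semistable `E`, whence the `2 log N` of Theorem 5.1).
* §4: "For the Manin constant we simply use the fact that `c ≥ 1`. So we have that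
  `deg φ ≥ (N/Ω)(0.033/log N^{(2)}) ∏ U_p(1)⁻¹ ≥ N D^{1/6}/(2675 log N^{(2)}) ∏ U_p(1)⁻¹`"
  (`D = |Δ_min|`, using Lemma 2.1: `1/Ω ≥ D^{1/6}/14.045`).
* Theorem 5.1: "`deg φ_E ≥ (N/Ω)(0.033/(2 log N)) ≥ N^{7/6}/(5350 log N)`" (semistable: `D ≥ N`).

The §1 formula with `c² ≥ 1` and Lemma 3.4 gives `deg φ ≥ (N/(2πΩ)) · 0.033/log N^{(2)}`: the
first display of §4 drops the factor `1/(2π)`, and the first inequality of Theorem 5.1 copies that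
display. The paper's own numerical constants show that the `2π` IS part of the intended bound:
`2675 = ⌈2π · 14.045/0.033⌉ = ⌈2674.2…⌉` (without the `2π` one would get `14.045/0.033 = 425.6…`),
and `5350 = 2 · 2675`, i.e. `⌈2π · 14.045 · 2/0.033⌉ = ⌈5348.3…⌉` rounded up to `2 · 2675`
(without the `2π`: `851.2…`); likewise `7150` and `10300` of Theorem 5.2 descend from `2675`.
Consequently:

* the SECOND conjunct of `watkins2004_thm_5_1` (`deg φ_E ≥ N^{7/6}/(5350 log N)`) is what the
  paper proves, as printed;
* the FIRST conjunct as printed (and vendored) asserts `2π` times more than the paper proves: by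
  Zagier's formula `deg · Ω = 4π² c² (f, f)` (proved in the tree,
  `ModularForms.ModularParametrizationData.zagier_degree_formula_holds`) it says
  `c² (f, f) ≥ 0.0165 N/(4π² log N)`, whereas §1 + Lemma 3.4 give `c² (f, f) ≥ 0.0165 N/(8π³ log N)`.
  Whether the stronger printed inequality holds is not addressed anywhere in the source (it would
  need `L(Sym² E, 1) · c² ≥ 2π · 0.033/(2 log N)`), so it must not be used as a proved result.

The statement established by the printed proof is recorded below, type-checked, as the conclusion
of `watkins2004_thm_5_1.corrected_of` (the printed form trivially implies it):
for semistable `E/ℚ`, `N ≥ 20000`, globally minimal `W`, any parametrisation datum `D` at level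
`N_E`: `deg ≥ (N/(2π · covol Λ_E)) · 0.033/(2 log N)` and `deg ≥ N^{7/6}/(5350 log N)`.
(It is not minted here as a separate named fact: under D-0026 a proving unit may not add unproved
`Prop` definitions; an operator may vendor it as `watkins2004_thm_5_1_corrected` with the cite
`[Watkins2004, Thm. 5.1 with §1, Lemma 2.1, Lemma 3.4, §4]`.)

## What is proved here

* `watkins2004_thm_5_1.numeric_step`: the real-arithmetic step "`≥ N^{7/6}/(5350 log N)`" of the
  printed proof — from `deg ≥ (N/(2πΩ)) · 0.033/(2 log N)`, `N ≥ 20000`, `Ω · D^{1/6} ≤ 14.045`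
  (Lemma 2.1) and `N ≤ D` one gets `deg ≥ N^{7/6}/(5350 log N)`, because
  `4π · 14.045 < 4 · 3.1416 · 14.045 = 176.49… ≤ 0.033 · 5350 = 176.55`.
* `conductorNorm_le_abs_Δ`: `N_E ≤ |Δ(W)|` for a globally minimal model `W/ℚ` (`N_E ∣ |Δ_min|`,
  `WeierstrassCurve.conductorNorm_dvd_minimalDiscriminantNorm`, and `|Δ_min| = |Δ(W)|`,
  `WeierstrassCurve.minimalDiscriminantNorm_int_eq_natAbs_minimalDiscriminantInt_holds`); this is
  the "`D ≥ N`" of the semistable case (true for every `E/ℚ`).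
* `watkins2004_thm_5_1.second_of_first`: in the tree's language, the second inequality of
  Theorem 5.1 for a datum `D` follows from the corrected first inequality for `D`, the named fact
  `watkins2004_lemma_2_1` (hypothesis) and `conductorNorm_le_abs_Δ` — exactly the last step of the
  printed proof.
* `watkins2004_thm_5_1.corrected_of`: the printed statement implies the corrected one
  (`2π ≥ 1`, `covol > 0`, `log N > 0`).
* `watkins2004_thm_5_1.second_of_first'`: as `second_of_first`, with Lemma 2.1 now PROVED in the
  tree (`watkins2004_lemma_2_1_holds`, `HeightCovolumeBoundsWatkinsLemmaProofs.lean`), so the second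
  inequality of Theorem 5.1 follows from the corrected first one with no further hypothesis.
* `watkins2004_thm_5_1.first_of_petersson_lower_bound`,
  `watkins2004_thm_5_1.corrected_of_petersson_lower_bound`: **the whole corrected Theorem 5.1 from
  one analytic inequality in the tree's vocabulary**, the explicit Petersson lower bound
  `(f, f) ≥ 0.033 N/(16π³ log N)` for the newform `f = D.f` — which is exactly what §1 (Shimura's
  identity `deg φ = (N c²/(2πΩ)) L(Sym² E, 1)`, combined with Zagier's `deg · Ω = 4π² c² (f, f)`:
  `(f, f) = N L(Sym² E, 1)/(8π³)`) and Lemma 3.4 (`L(Sym² f_E, 1) ≥ 0.033/log N^{(2)}`,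
  `N^{(2)} = N²`) give for semistable `E`. The derivation uses only Zagier's formula
  (`ModularParametrizationData.zagier_degree_formula_holds`, proved) and `c² ≥ 1`
  (`c ∈ ℤ ∖ {0}`, `maninConstant_ne_zero_holds`, proved) — Watkins' "for the Manin constant we
  simply use the fact that `c ≥ 1`" (§4). This isolates the single missing (apex) input.

Not proved (and why the fact is apex-sized): the first inequality itself needs the analytic
continuation and functional equation of `L(Sym² f, s)` (Shimura 1975, Gelbart–Jacquet 1978) and of
`L(Sym⁴ f, s)` (Kim 2003, Kim–Shahidi 2002), the double pole of
`ζ² L(Sym² f)³ L(Sym⁴ f)` at `s = 1` (Bump–Ginzburg 1992), the explicit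
Goldfeld–Hoffstein–Lieman zero-free region and Rademacher's Phragmén–Lindelöf bounds
(Lemmas 3.1, 3.3, 3.4), and the Rankin–Selberg unfolding behind Shimura's identity; none of these
objects exists in Mathlib or in `Literature/` (which has only Zagier's formula and the period
lattice/`Δ(τ)` dictionary of `SilvermanHeightCovolumeProofs.lean`).

## References

* [Watkins2004] M. Watkins, *Explicit lower bounds on the modular degree of an elliptic curve*,
  arXiv:math/0408126 — §1 (Shimura's identity), Lemma 2.1, Lemma 3.4, §4, Theorems 5.1–5.2
  (held; read in full, pp. 1–11 of the arXiv text).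
* [ZagierCMB1985] D. Zagier, *Modular parametrizations of elliptic curves*, Canad. Math. Bull. 28
  (1985), §1.
-/

noncomputable section

open Literature.NumberTheory.EllipticCurves.ModularForms CongruenceSubgroup

namespace Literature.NumberTheory.EllipticCurves

/-- **The arithmetic step "`≥ N^{7/6}/(5350 log N)`" of [Watkins2004], Theorem 5.1** (§4 and
Thm. 5.1), over the reals: if `deg ≥ (N/(2πΩ)) · 0.033/(2 log N)` with `N ≥ 20000`, if
`Ω · D^{1/6} ≤ 14.045` (Lemma 2.1: `1/Ω ≥ D^{1/6}/14.045`) and `N ≤ D` (semistable: `N = rad Δ_min`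
divides `D = |Δ_min|`), then `deg ≥ N^{7/6}/(5350 log N)`, because
`4π · 14.045 < 4 · 3.1416 · 14.045 = 176.49… ≤ 0.033 · 5350 = 176.55` — i.e. the printed constant
`5350 = 2 · 2675`, `2675 = ⌈2π · 14.045/0.033⌉`, carries the factor `2π` of Shimura's identity (§1).
[cite: Watkins2004, §4 and Theorem 5.1] -/
theorem watkins2004_thm_5_1.numeric_step {deg Ω N D : ℝ} (hN : 20000 ≤ N) (hΩ : 0 < Ω)
    (hND : N ≤ D) (h21 : Ω * D ^ (1 / 6 : ℝ) ≤ 14.045)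
    (h1 : N / (2 * Real.pi * Ω) * (0.033 / (2 * Real.log N)) ≤ deg) :
    N ^ (7 / 6 : ℝ) / (5350 * Real.log N) ≤ deg := by
  have hNpos : 0 < N := by linarith
  have hlog : 0 < Real.log N := Real.log_pos (by linarith)
  have ha : 0 < N ^ (1 / 6 : ℝ) := Real.rpow_pos_of_pos hNpos _
  have hN16 : N ^ (1 / 6 : ℝ) ≤ D ^ (1 / 6 : ℝ) :=
    Real.rpow_le_rpow hNpos.le hND (by norm_num)
  have hΩa : Ω * N ^ (1 / 6 : ℝ) ≤ 14.045 := (mul_le_mul_of_nonneg_left hN16 hΩ.le).trans h21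
  have h76 : N ^ (7 / 6 : ℝ) = N * N ^ (1 / 6 : ℝ) := by
    rw [show (7 / 6 : ℝ) = 1 + 1 / 6 by norm_num, Real.rpow_add hNpos, Real.rpow_one]
  refine le_trans ?_ h1
  rw [h76, div_le_iff₀ (by positivity)]
  have hrw : N / (2 * Real.pi * Ω) * (0.033 / (2 * Real.log N)) * (5350 * Real.log N) =
      N * ((0.033 * 5350) / (4 * Real.pi * Ω)) := by
    field_simp
    ring
  rw [hrw]
  refine mul_le_mul_of_nonneg_left ?_ hNpos.le
  rw [le_div_iff₀ (by positivity)]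
  calc N ^ (1 / 6 : ℝ) * (4 * Real.pi * Ω) = 4 * Real.pi * (Ω * N ^ (1 / 6 : ℝ)) := by ring
    _ ≤ 4 * Real.pi * 14.045 := by gcongr
    _ ≤ 4 * 3.1416 * 14.045 := by gcongr; exact Real.pi_lt_d4.le
    _ ≤ 0.033 * 5350 := by norm_num

/-- **`N_E ≤ |Δ(W)|` for a globally minimal model `W/ℚ`** (the "`D ≥ N`" of [Watkins2004], §4 and
Thm. 5.1, there for semistable `E`, where `N = rad Δ_min`; in fact for every `E/ℚ`): the conductor
divides the minimal discriminant (`f_p ≤ ord_p Δ_min`, Silverman AEC VIII.11, ATAEC IV.11.1: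
`WeierstrassCurve.conductorNorm_dvd_minimalDiscriminantNorm`), and for a globally minimal `W` the
minimal discriminant is `|Δ(W)|`
(`WeierstrassCurve.minimalDiscriminantNorm_int_eq_natAbs_minimalDiscriminantInt_holds`,
`WeierstrassCurve.cast_minimalDiscriminantInt`). Stated in the coercions of `watkins2004_lemma_2_1`.
[cite: SilvermanAEC2009, VIII.11 (conductor divides minimal discriminant) and VIII.8] -/
theorem conductorNorm_le_abs_Δ (W : WeierstrassCurve ℚ) [W.IsElliptic] [W.IsGloballyMinimal] :
    (W.conductorNorm ℤ : ℝ) ≤ ((|W.Δ| : ℚ) : ℝ) := by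
  have hDpos : 0 < W.minimalDiscriminantNorm ℤ := WeierstrassCurve.minimalDiscriminantNorm_pos_holds W
  have hdvd : W.conductorNorm ℤ ∣ W.minimalDiscriminantNorm ℤ :=
    WeierstrassCurve.conductorNorm_dvd_minimalDiscriminantNorm W
      (WeierstrassCurve.finite_setOf_ordMinimalDiscriminant_ne_zero_holds W)
  have hle : W.conductorNorm ℤ ≤ (WeierstrassCurve.minimalDiscriminantInt W).natAbs := by
    rw [← WeierstrassCurve.minimalDiscriminantNorm_int_eq_natAbs_minimalDiscriminantInt_holds W]
    exact Nat.le_of_dvd hDpos hdvd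
  have hΔ : ((|W.Δ| : ℚ) : ℝ) = (((WeierstrassCurve.minimalDiscriminantInt W).natAbs : ℕ) : ℝ) := by
    rw [← WeierstrassCurve.cast_minimalDiscriminantInt W, Rat.cast_abs, Rat.cast_intCast,
      Nat.cast_natAbs, Int.cast_abs]
  rw [hΔ]
  exact_mod_cast hle

/-- **The last step of the proof of [Watkins2004], Theorem 5.1, in the tree's language.** For a
globally minimal `W/ℚ` of conductor `N ≥ 20000` and a parametrisation datum `D` at level `N`, the
(corrected) first inequality `deg ≥ (N/(2π covol Λ_E)) · 0.033/(2 log N)` together with Lemma 2.1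
(`watkins2004_lemma_2_1`, applied to the Néron lattice `D.L` of `W`: `covol · |Δ(W)|^{1/6} ≤ 14.045`)
and `N ≤ |Δ(W)|` (`conductorNorm_le_abs_Δ`) gives the second inequality
`deg ≥ N^{7/6}/(5350 log N)` (`watkins2004_thm_5_1.numeric_step`). Semistability is not needed for
this step. [cite: Watkins2004, Theorem 5.1 (second inequality) with Lemma 2.1 and §4] -/
theorem watkins2004_thm_5_1.second_of_first (h21 : watkins2004_lemma_2_1)
    (W : WeierstrassCurve ℚ) [W.IsElliptic] [W.IsGloballyMinimal] [NeZero (W.conductorNorm ℤ)]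
    (hN : 20000 ≤ W.conductorNorm ℤ) (D : ModularParametrizationData W (W.conductorNorm ℤ))
    (h1 : (W.conductorNorm ℤ : ℝ) / (2 * Real.pi * ZLattice.covolume D.L.lattice) *
        (0.033 / (2 * Real.log (W.conductorNorm ℤ))) ≤ (D.modularDegree : ℝ)) :
    (W.conductorNorm ℤ : ℝ) ^ (7 / 6 : ℝ) / (5350 * Real.log (W.conductorNorm ℤ)) ≤
      (D.modularDegree : ℝ) :=
  watkins2004_thm_5_1.numeric_step (by exact_mod_cast hN) (ZLattice.covolume_pos D.L.lattice _)
    (conductorNorm_le_abs_Δ W) (h21 W D.L D.isNeronLattice) h1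

/-- **[Watkins2004], Theorem 5.1 as established by its printed proof**, recorded as a consequence
of the statement as printed. The conclusion is the corrected Theorem 5.1: for semistable `E/ℚ` with
`N ≥ 20000`, globally minimal model `W`, and any modular parametrisation datum `D` at level `N_E`,
`deg ≥ (N/(2π · covol Λ_E)) · 0.033/(2 log N)` and `deg ≥ N^{7/6}/(5350 log N)` — the first
inequality WITH the factor `1/(2π)` of Shimura's identity `deg φ = (N c²/(2πΩ)) L(Sym² E, 1)` (§1)
that the printed Theorem 5.1 (= `watkins2004_thm_5_1`, first conjunct) omits although its constants
`2675 = ⌈2π · 14.045/0.033⌉`, `5350 = 2 · 2675` contain it (see the module docstring). The printed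
form implies the corrected one since `2π ≥ 1`, `covol Λ_E > 0` and `log N > 0`; the converse is not
claimed. [cite: Watkins2004, Theorem 5.1 with §1 (Shimura's identity), Lemma 3.4 and §4] -/
theorem watkins2004_thm_5_1.corrected_of (h : watkins2004_thm_5_1) :
    ∀ (W : WeierstrassCurve ℚ) [W.IsElliptic] [W.IsGloballyMinimal] [NeZero (W.conductorNorm ℤ)],
      W.IsSemistable ℤ → 20000 ≤ W.conductorNorm ℤ →
      ∀ D : ModularParametrizationData W (W.conductorNorm ℤ),
        (W.conductorNorm ℤ : ℝ) / (2 * Real.pi * ZLattice.covolume D.L.lattice) *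
              (0.033 / (2 * Real.log (W.conductorNorm ℤ))) ≤ (D.modularDegree : ℝ) ∧
          (W.conductorNorm ℤ : ℝ) ^ (7 / 6 : ℝ) / (5350 * Real.log (W.conductorNorm ℤ)) ≤
            (D.modularDegree : ℝ) := by
  intro W _ _ _ hss hN D
  obtain ⟨h1, h2⟩ := h W hss hN D
  refine ⟨le_trans ?_ h1, h2⟩
  have hΩ : 0 < ZLattice.covolume D.L.lattice := ZLattice.covolume_pos D.L.lattice _
  have hN' : (20000 : ℝ) ≤ (W.conductorNorm ℤ : ℝ) := by exact_mod_cast hN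
  have hlog : 0 < Real.log (W.conductorNorm ℤ : ℝ) := Real.log_pos (by linarith)
  have hx : (0 : ℝ) ≤ 0.033 / (2 * Real.log (W.conductorNorm ℤ : ℝ)) := by positivity
  refine mul_le_mul_of_nonneg_right ?_ hx
  refine div_le_div_of_nonneg_left (by positivity) hΩ ?_
  have hπ : (1 : ℝ) ≤ 2 * Real.pi := by linarith [Real.pi_gt_three]
  nlinarith

/-- **The last step of [Watkins2004], Theorem 5.1, unconditionally in Lemma 2.1.** Same as
`watkins2004_thm_5_1.second_of_first`, with the hypothesis `watkins2004_lemma_2_1` discharged by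
the tree's proof `watkins2004_lemma_2_1_holds` (`HeightCovolumeBoundsWatkinsLemmaProofs.lean`): for a
globally minimal `W/ℚ` with `N ≥ 20000` and any parametrisation datum `D` at level `N_E`, the
corrected first inequality `deg ≥ (N/(2π covol Λ_E)) · 0.033/(2 log N)` implies
`deg ≥ N^{7/6}/(5350 log N)`. [cite: Watkins2004, Theorem 5.1 (second inequality) with Lemma 2.1 and §4] -/
theorem watkins2004_thm_5_1.second_of_first'
    (W : WeierstrassCurve ℚ) [W.IsElliptic] [W.IsGloballyMinimal] [NeZero (W.conductorNorm ℤ)]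
    (hN : 20000 ≤ W.conductorNorm ℤ) (D : ModularParametrizationData W (W.conductorNorm ℤ))
    (h1 : (W.conductorNorm ℤ : ℝ) / (2 * Real.pi * ZLattice.covolume D.L.lattice) *
        (0.033 / (2 * Real.log (W.conductorNorm ℤ))) ≤ (D.modularDegree : ℝ)) :
    (W.conductorNorm ℤ : ℝ) ^ (7 / 6 : ℝ) / (5350 * Real.log (W.conductorNorm ℤ)) ≤
      (D.modularDegree : ℝ) :=
  watkins2004_thm_5_1.second_of_first watkins2004_lemma_2_1_holds W hN D h1

/-- **`deg · covol ≥ 4π² (f, f)` for every parametrisation datum** (Zagier's formula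
`4π² c² (f, f) = deg · covol Λ_E`, `ModularParametrizationData.zagier_degree_formula_holds`, and
`c² ≥ 1` for the integer `c ≠ 0`, `maninConstant_ne_zero_holds`) — Watkins' "for the Manin
constant we simply use the fact that `c ≥ 1`" ([Watkins2004], §4), in Petersson form.
[cite: Watkins2004, §4; ZagierCMB1985, §1] -/
theorem four_pi_sq_mul_peterssonProduct_re_le_deg_mul_covolume {N : ℕ} [NeZero N]
    {W : WeierstrassCurve ℚ} (D : ModularParametrizationData W N) :
    4 * Real.pi ^ 2 * (peterssonProduct (Gamma0 N) 2 D.f D.f).re ≤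
      (D.modularDegree : ℝ) * ZLattice.covolume D.L.lattice := by
  -- Zagier: `4π² c² · Re (f,f) = deg · covol`
  have hZ : 4 * Real.pi ^ 2 * (D.c : ℝ) ^ 2 * (peterssonProduct (Gamma0 N) 2 D.f D.f).re =
      (D.modularDegree : ℝ) * ZLattice.covolume D.L.lattice := by
    have h := congrArg Complex.re D.zagier_degree_formula_holds
    rw [Complex.re_ofReal_mul, Complex.ofReal_re] at h
    exact h
  set P : ℝ := (peterssonProduct (Gamma0 N) 2 D.f D.f).re with hPdef
  have hc0 : D.c ≠ 0 := D.maninConstant_ne_zero_holds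
  have hc1 : (1 : ℝ) ≤ (D.c : ℝ) ^ 2 := by
    have h : (1 : ℤ) ≤ D.c ^ 2 := (one_le_sq_iff_one_le_abs _).mpr (Int.one_le_abs hc0)
    exact_mod_cast h
  have hcov : 0 < ZLattice.covolume D.L.lattice := ZLattice.covolume_pos D.L.lattice _
  have hdeg : (0 : ℝ) ≤ (D.modularDegree : ℝ) := Nat.cast_nonneg _
  -- `Re (f,f) ≥ 0` follows from `hZ` (right-hand side `≥ 0`, `c² > 0`)
  have hP : 0 ≤ P := by
    have h1 : 0 ≤ 4 * Real.pi ^ 2 * (D.c : ℝ) ^ 2 * P := by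
      rw [hZ]; exact mul_nonneg hdeg hcov.le
    have h2 : (0 : ℝ) < 4 * Real.pi ^ 2 * (D.c : ℝ) ^ 2 := by positivity
    by_contra hneg
    push Not at hneg
    have : 4 * Real.pi ^ 2 * (D.c : ℝ) ^ 2 * P < 0 := mul_neg_of_pos_of_neg h2 hneg
    linarith
  have h4 : 0 ≤ 4 * Real.pi ^ 2 * P := mul_nonneg (by positivity) hP
  have h5 : 4 * Real.pi ^ 2 * P * 1 ≤ 4 * Real.pi ^ 2 * P * (D.c : ℝ) ^ 2 :=
    mul_le_mul_of_nonneg_left hc1 h4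
  have key : 4 * Real.pi ^ 2 * P ≤ 4 * Real.pi ^ 2 * (D.c : ℝ) ^ 2 * P := by
    calc 4 * Real.pi ^ 2 * P = 4 * Real.pi ^ 2 * P * 1 := by ring
      _ ≤ 4 * Real.pi ^ 2 * P * (D.c : ℝ) ^ 2 := h5
      _ = 4 * Real.pi ^ 2 * (D.c : ℝ) ^ 2 * P := by ring
  exact key.trans_eq hZ

/-- **The (corrected) first inequality of [Watkins2004], Theorem 5.1, from the explicit Petersson
lower bound.** For any `W/ℚ`, level `N ≥ 2` and parametrisation datum `D`: if the newform `f = D.f`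
satisfies `(f, f) ≥ 0.033 N/(16π³ log N)`, then `deg ≥ (N/(2π covol Λ)) · 0.033/(2 log N)`.
In the paper this is §1 + Lemma 3.4 + "`c ≥ 1`" (§4): Shimura's identity
`deg φ = (N c²/(2πΩ)) L(Sym² E, 1)` (semistable `E`: no `U_p` factors) reads, through Zagier's
`deg · Ω = 4π² c² (f, f)` (proved in the tree), `(f, f) = N L(Sym² E, 1)/(8π³)`, and Lemma 3.4 gives
`L(Sym² f_E, 1) ≥ 0.033/log N^{(2)} = 0.033/(2 log N)`; so the hypothesis below is Lemma 3.4 in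
Petersson form, the one analytic input of Theorem 5.1 that the tree does not have (no
symmetric-square `L`-function). Only `deg · covol ≥ 4π² (f, f)`
(`four_pi_sq_mul_peterssonProduct_re_le_deg_mul_covolume`) is used.
[cite: Watkins2004, §1, Lemma 3.4, §4 and Theorem 5.1 (first inequality, with the `2π` of §1)] -/
theorem watkins2004_thm_5_1.first_of_petersson_lower_bound {N : ℕ} [NeZero N]
    {W : WeierstrassCurve ℚ} (hN : 2 ≤ N) (D : ModularParametrizationData W N)
    (hP : 0.033 * (N : ℝ) / (16 * Real.pi ^ 3 * Real.log N) ≤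
      (peterssonProduct (Gamma0 N) 2 D.f D.f).re) :
    (N : ℝ) / (2 * Real.pi * ZLattice.covolume D.L.lattice) * (0.033 / (2 * Real.log N)) ≤
      (D.modularDegree : ℝ) := by
  have hcov : 0 < ZLattice.covolume D.L.lattice := ZLattice.covolume_pos D.L.lattice _
  have hN' : (2 : ℝ) ≤ (N : ℝ) := by exact_mod_cast hN
  have hlog : 0 < Real.log (N : ℝ) := Real.log_pos (by linarith)
  have hπ : 0 < Real.pi := Real.pi_pos
  have key := (mul_le_mul_of_nonneg_left hP (by positivity : (0 : ℝ) ≤ 4 * Real.pi ^ 2)).trans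
    (four_pi_sq_mul_peterssonProduct_re_le_deg_mul_covolume D)
  -- `key : 4π² · (0.033 N/(16π³ log N)) ≤ deg · covol`
  have key' : 4 * Real.pi ^ 2 * (0.033 * (N : ℝ) / (16 * Real.pi ^ 3 * Real.log N)) /
      ZLattice.covolume D.L.lattice ≤ (D.modularDegree : ℝ) := (div_le_iff₀ hcov).mpr key
  refine le_trans (le_of_eq ?_) key'
  have hπ' : Real.pi ≠ 0 := hπ.ne'
  have hlog' : Real.log (N : ℝ) ≠ 0 := hlog.ne'
  have hcov' : ZLattice.covolume D.L.lattice ≠ 0 := hcov.ne'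
  field_simp
  ring

/-- **[Watkins2004], Theorem 5.1 as established by its printed proof, from its one missing
analytic input.** For a globally minimal `W/ℚ` with conductor `N ≥ 20000` and any parametrisation
datum `D` at level `N`: if `(f, f) ≥ 0.033 N/(16π³ log N)` for the newform `f = D.f` (= §1 +
Lemma 3.4 of the paper in Petersson form, see `first_of_petersson_lower_bound`; for semistable `E`
this is what the paper proves), then BOTH inequalities of the corrected Theorem 5.1 hold:
`deg ≥ (N/(2π covol Λ_E)) · 0.033/(2 log N)` and `deg ≥ N^{7/6}/(5350 log N)`. Everything else in
the printed proof is proved in the tree: Zagier's formula, `c² ≥ 1`, Lemma 2.1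
(`watkins2004_lemma_2_1_holds`), `N ≤ |Δ_min|` (`conductorNorm_le_abs_Δ`) and the arithmetic
(`numeric_step`). Semistability enters only through the hypothesis.
[cite: Watkins2004, Theorem 5.1 with §1, Lemma 2.1, Lemma 3.4, §4] -/
theorem watkins2004_thm_5_1.corrected_of_petersson_lower_bound
    (W : WeierstrassCurve ℚ) [W.IsElliptic] [W.IsGloballyMinimal] [NeZero (W.conductorNorm ℤ)]
    (hN : 20000 ≤ W.conductorNorm ℤ) (D : ModularParametrizationData W (W.conductorNorm ℤ))
    (hP : 0.033 * (W.conductorNorm ℤ : ℝ) / (16 * Real.pi ^ 3 * Real.log (W.conductorNorm ℤ)) ≤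
      (peterssonProduct (Gamma0 (W.conductorNorm ℤ)) 2 D.f D.f).re) :
    (W.conductorNorm ℤ : ℝ) / (2 * Real.pi * ZLattice.covolume D.L.lattice) *
          (0.033 / (2 * Real.log (W.conductorNorm ℤ))) ≤ (D.modularDegree : ℝ) ∧
      (W.conductorNorm ℤ : ℝ) ^ (7 / 6 : ℝ) / (5350 * Real.log (W.conductorNorm ℤ)) ≤
        (D.modularDegree : ℝ) :=
  have h1 := watkins2004_thm_5_1.first_of_petersson_lower_bound (le_trans (by norm_num) hN) D hP
  ⟨h1, watkins2004_thm_5_1.second_of_first' W hN D h1⟩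

end Literature.NumberTheory.EllipticCurves

end
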